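import Mathlib.Analysis.Fourier.FourierTransformDeriv
import Literature.Analysis.FluidPDE.HomSobolevRepresentedL3
import Literature.Analysis.FluidPDE.FujitaKatoLocal
import HarnessLib

/-!
# Frequency splitting of `Ḣ^{1/2}(ℝ³)`-represented data (Calderón's trick on the Fourier side)

Analysis/FluidPDE support file, definitions-free. Rusin–Šverák, J. Funct. Anal. 260 (2011) =
arXiv:0911.0500, §4 p. 6, construct their Leray solutions `NS(u₀)` for `Ḣ^{1/2}` data by
"the following trick by C. Calderón [...]: we can write `u₀ = a₀ + v₀` with `a₀` smooth and
small in `Ḣ^{1/2}`, and `v₀` in `L²`. (For example, `a₀` can be defined in terms of the Fourier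
transform as `â₀(ξ) = û₀(ξ)φ(ξ)`, where `φ` is a suitable smooth function equal to `1` in a
small neighborhood of `0`.)" The same low/high-frequency splitting of an `Ḣ^{1/2}` datum is the
first step of the sketch "the only reason for `T_max(u₀) < ∞` can be a finite time singularity"
(loc. cit., the decomposition `u = a + v`), of Jia–Šverák 2013 (arXiv:1201.1592, Lemma 7 and
Remark 1: `u₀ = a + b`, `b ∈ L²`) and of Lemarié-Rieusset 2016, proof of Prop. 15.1
(`u₀ = α_η + β_η`, `α_η ∈ L²`), i.e. of every printed proof of the tree's named facts
`rusin_sverak_singular_point_of_blowup` and `rusin_sverak_weak_limit_of_singular_points`.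

In the tree a datum is a field *represented* by a class `g ∈ Ḣ^{1/2}(ℝ³; F) = L²(‖ξ‖ dξ; F)`
(`HomSobolev.Represents`). This file **proves** the splitting at the level of represented
fields, with the sharp cutoff `φ = 1_{B(0,Λ)}` (any complex Hilbert space `F`; reality and
divergence-freeness of the pieces for Navier–Stokes data are added in
`HomSobolevCalderonSplitting.lean`):

* `HomSobolev.exists_indicator_pair` — `g = g₁ + g₂` with `ĝ₁ = 1_A ĝ`, `ĝ₂ = 1_{Aᶜ} ĝ`,
  `‖gᵢ‖ ≤ ‖g‖` (orthogonal truncation of the stored class);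
* `HomSobolev.integrable_indicator_ball_toLp` — the low-frequency symbol `1_{B(0,Λ)} ĝ` is in
  `L¹(dξ)` with `‖1_{B(0,Λ)} ĝ‖_{L¹} ≤ Λ J₁^{1/2} ‖g‖`, `J₁ = ∫_{B(0,1)} ‖ξ‖⁻¹ dξ`
  (Cauchy–Schwarz, the tree's `SobolevEmbeddingHalf.lintegral_ball_enorm_le_mul`);
* `HomSobolev.memLp_indicator_compl_ball_toLp` — the high-frequency symbol `1_{B(0,Λ)ᶜ} ĝ` is
  in `L²(dξ)` with `‖1_{B(0,Λ)ᶜ} ĝ‖_{L²} ≤ Λ^{-1/2} ‖g‖` (`‖ξ‖ ≥ Λ` there);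
* `HomSobolev.fourierInv_indicator_ball_toLp` — the low part is represented by the inverse
  Fourier *integral* `a₀ = 𝓕⁻¹(1_{B(0,Λ)} ĝ)`, a bounded (`‖a₀‖_∞ ≤ Λ J₁^{1/2} ‖g‖`),
  continuous, `C^∞` function (moments of a compactly supported `L¹` symbol; Mathlib
  `Real.contDiff_fourier`), the pairing identity being the self-adjointness
  `∫ 𝓕⁻¹ψ • G = ∫ ψ • 𝓕⁻¹G` (`SobolevEmbeddingHalf.integral_fourierInv_schwartz_smul_eq`);
* `HomSobolev.exists_represents_indicator_compl_ball_toLp` — the high part is represented by an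
  `L²` function `v₀` (Plancherel, Mathlib's `L²` Fourier transform) with
  `‖v₀‖_{L²} ≤ Λ^{-1/2} ‖g‖`;
* `HomSobolev.Represents.exists_frequency_split` — **the splitting**: if `g` represents `f`,
  then `f = a₀ + v₀` a.e. with the above pieces and bounds
  (`Represents.add`, `Represents.ae_eq` of `HomSobolevRepresentedL3.lean`);
* `HomSobolev.tendsto_eLpNorm_indicator_ball_toLp`, `HomSobolev.exists_eLpNorm_indicator_ball_toLp_lt`
  — **smallness**: `‖1_{B(0,Λ)} ĝ‖_{L²(‖ξ‖dξ)} → 0` as `Λ → 0` (dominated convergence), so the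
  `Ḣ^{1/2}` norm of the low part is as small as desired ("`a₀` small in `Ḣ^{1/2}`").

## Mathlib / tree search

Mathlib: `Real.fourierInv_eq`, `Real.fourierInv_eq_fourier_comp_neg`, `Real.contDiff_fourier`,
`MeasureTheory.Lp` Fourier transform (`fourier_fourierInv_eq`, `Lp.norm_fourier_eq`),
`eLpNorm_indicator_le`, `tendsto_lintegral_of_dominated_convergence'`. Tree:
`SobolevEmbeddingHalf.continuous_fourierIntegralInv`, `.norm_fourierIntegralInv_le_integral_norm`,
`.integral_fourierInv_schwartz_smul_eq`, `.lintegral_ball_enorm_le_mul`,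
`.lintegral_unitBall_inv_enorm_ne_top` (`FourierSobolevNormEmbeddingProofs.lean`),
`HomSobolev.integral_fourier_smul_eq_integral_smul_fourier_Lp` (`MildSolutionsProofs.lean`),
`integrable_schwartz_smul` (`FujitaKatoLocal.lean`), `integrable_smul_of_memLp_half`
(`HomSobolevWeakLimits.lean`), `HomSobolev.Represents.add/ae_eq` (`HomSobolevRepresentedL3.lean`).

## References

* W. Rusin, V. Šverák, J. Funct. Anal. 260 (2011) = arXiv:0911.0500, §4 p. 6.
* C. P. Calderón, Trans. AMS 318 (1990) 179–200 (weak solutions with `L^p` data; the trick).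
* H. Jia, V. Šverák, SIAM J. Math. Anal. 45 (2013) = arXiv:1201.1592, Lemma 7, Remark 1.
* P. G. Lemarié-Rieusset, *The Navier–Stokes problem in the 21st century* (2016), Prop. 15.1.
* J.-Y. Chemin, C.-J. Xu, Ann. Sci. ÉNS 30 (1997), (8)–(9) (the low/high frequency splitting).
-/

noncomputable section

open MeasureTheory Set Function Filter Topology FourierTransform Real SchwartzMap
open scoped ENNReal NNReal InnerProductSpace ComplexConjugate

namespace Literature.Analysis.FluidPDE

section Truncation
open Literature.Analysis.FunctionSpaces (HomSobolev)
open Literature.Analysis.FunctionSpaces.HomSobolev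

universe u

variable {F : Type u} [NormedAddCommGroup F] [InnerProductSpace ℂ F] [CompleteSpace F]

omit [CompleteSpace F] in
/-- **Orthogonal truncation of a class in `Ḣ^{1/2}(ℝ³)`**: for a measurable set `A` of
frequencies, `g = g₁ + g₂` where the stored classes of `g₁`, `g₂` are `1_A ĝ` and `1_{Aᶜ} ĝ`
(Lebesgue-a.e.), with `‖g₁‖ = ‖1_A ĝ‖_{L²(‖ξ‖dξ)}`, `‖g₂‖ = ‖1_{Aᶜ} ĝ‖_{L²(‖ξ‖dξ)}`, both `≤ ‖g‖`
(`â₀ = φ û₀`, `v̂₀ = (1 - φ) û₀` with the sharp cutoff `φ = 1_A`; Rusin–Šverák 2011, §4 p. 6).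
[cite: RusinSverak2011, §4 p. 6 (arXiv:0911.0500: Calderón splitting â₀ = û₀ φ)] -/
theorem _root_.Literature.Analysis.FunctionSpaces.HomSobolev.exists_indicator_pair
    (g : HomSobolev (EuclideanSpace ℝ (Fin 3)) F (1 / 2 : ℝ)) {A : Set (EuclideanSpace ℝ (Fin 3))}
    (hA : MeasurableSet A) :
    ∃ g₁ g₂ : HomSobolev (EuclideanSpace ℝ (Fin 3)) F (1 / 2 : ℝ), g = g₁ + g₂ ∧
      ((toLp (1 / 2 : ℝ) g₁ : Lp F 2 (FunctionSpaces.homSobolevMeasure (EuclideanSpace ℝ (Fin 3)) (1 / 2 : ℝ))) :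
          EuclideanSpace ℝ (Fin 3) → F) =ᵐ[volume]
        A.indicator ((toLp (1 / 2 : ℝ) g : Lp F 2 (FunctionSpaces.homSobolevMeasure (EuclideanSpace ℝ (Fin 3)) (1 / 2 : ℝ))) :
          EuclideanSpace ℝ (Fin 3) → F) ∧
      ((toLp (1 / 2 : ℝ) g₂ : Lp F 2 (FunctionSpaces.homSobolevMeasure (EuclideanSpace ℝ (Fin 3)) (1 / 2 : ℝ))) :
          EuclideanSpace ℝ (Fin 3) → F) =ᵐ[volume]
        Aᶜ.indicator ((toLp (1 / 2 : ℝ) g : Lp F 2 (FunctionSpaces.homSobolevMeasure (EuclideanSpace ℝ (Fin 3)) (1 / 2 : ℝ))) :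
          EuclideanSpace ℝ (Fin 3) → F) ∧
      ‖g₁‖ = (eLpNorm (A.indicator ((toLp (1 / 2 : ℝ) g : Lp F 2
          (FunctionSpaces.homSobolevMeasure (EuclideanSpace ℝ (Fin 3)) (1 / 2 : ℝ))) : EuclideanSpace ℝ (Fin 3) → F))
          2 (FunctionSpaces.homSobolevMeasure (EuclideanSpace ℝ (Fin 3)) (1 / 2 : ℝ))).toReal ∧
      ‖g₂‖ = (eLpNorm (Aᶜ.indicator ((toLp (1 / 2 : ℝ) g : Lp F 2
          (FunctionSpaces.homSobolevMeasure (EuclideanSpace ℝ (Fin 3)) (1 / 2 : ℝ))) : EuclideanSpace ℝ (Fin 3) → F))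
          2 (FunctionSpaces.homSobolevMeasure (EuclideanSpace ℝ (Fin 3)) (1 / 2 : ℝ))).toReal ∧
      ‖g₁‖ ≤ ‖g‖ ∧ ‖g₂‖ ≤ ‖g‖ := by
  set μ := FunctionSpaces.homSobolevMeasure (EuclideanSpace ℝ (Fin 3)) (1 / 2 : ℝ) with hμ
  have hac : (volume : Measure (EuclideanSpace ℝ (Fin 3))) ≪ μ :=
    HomSobolevSymmetry.volume_absolutelyContinuous_homSobolevMeasure_half
  set G : EuclideanSpace ℝ (Fin 3) → F := ((toLp (1 / 2 : ℝ) g : Lp F 2 μ) : EuclideanSpace ℝ (Fin 3) → F)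
    with hG_def
  have hG : MemLp G 2 μ := Lp.memLp _
  have h1 : MemLp (A.indicator G) 2 μ := hG.indicator hA
  have h2 : MemLp (Aᶜ.indicator G) 2 μ := hG.indicator hA.compl
  set g₁ : HomSobolev (EuclideanSpace ℝ (Fin 3)) F (1 / 2 : ℝ) := (toLp (1 / 2 : ℝ)).symm (h1.toLp _) with hg₁
  set g₂ : HomSobolev (EuclideanSpace ℝ (Fin 3)) F (1 / 2 : ℝ) := (toLp (1 / 2 : ℝ)).symm (h2.toLp _) with hg₂
  have hc₁ : ((toLp (1 / 2 : ℝ) g₁ : Lp F 2 μ) : EuclideanSpace ℝ (Fin 3) → F) =ᵐ[μ] A.indicator G := by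
    rw [hg₁, LinearIsometryEquiv.apply_symm_apply]
    exact h1.coeFn_toLp
  have hc₂ : ((toLp (1 / 2 : ℝ) g₂ : Lp F 2 μ) : EuclideanSpace ℝ (Fin 3) → F) =ᵐ[μ] Aᶜ.indicator G := by
    rw [hg₂, LinearIsometryEquiv.apply_symm_apply]
    exact h2.coeFn_toLp
  have hn₁ : ‖g₁‖ = (eLpNorm (A.indicator G) 2 μ).toReal := by
    rw [norm_def, hg₁, LinearIsometryEquiv.apply_symm_apply, Lp.norm_toLp]
  have hn₂ : ‖g₂‖ = (eLpNorm (Aᶜ.indicator G) 2 μ).toReal := by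
    rw [norm_def, hg₂, LinearIsometryEquiv.apply_symm_apply, Lp.norm_toLp]
  have hng : ‖g‖ = (eLpNorm G 2 μ).toReal := by
    rw [norm_def, Lp.norm_def]
  refine ⟨g₁, g₂, ?_, hac.ae_eq hc₁, hac.ae_eq hc₂, hn₁, hn₂, ?_, ?_⟩
  · apply (toLp (1 / 2 : ℝ)).injective
    rw [map_add]
    refine Lp.ext ?_
    filter_upwards [Lp.coeFn_add (toLp (1 / 2 : ℝ) g₁ : Lp F 2 μ) (toLp (1 / 2 : ℝ) g₂ : Lp F 2 μ), hc₁, hc₂]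
      with ξ hadd h₁ h₂
    rw [hadd, Pi.add_apply, h₁, h₂]
    exact (congrFun (Set.indicator_self_add_compl A G) ξ).symm
  · rw [hn₁, hng]
    exact ENNReal.toReal_mono hG.eLpNorm_ne_top (eLpNorm_indicator_le _)
  · rw [hn₂, hng]
    exact ENNReal.toReal_mono hG.eLpNorm_ne_top (eLpNorm_indicator_le _)

omit [CompleteSpace F] in
/-- The `Ḣ^{1/2}(ℝ³)` norm of a class on the Fourier side: `‖g‖ = (∫ ‖ξ‖ ‖ĝ(ξ)‖² dξ)^{1/2}`
(Bahouri–Chemin–Danchin 2011, Def. 1.31; unfolding of the weighted `L²` norm).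
[cite: BahouriCheminDanchin2011, Def. 1.31] -/
theorem _root_.Literature.Analysis.FunctionSpaces.HomSobolev.enorm_eq_lintegral_weight
    (g : HomSobolev (EuclideanSpace ℝ (Fin 3)) F (1 / 2 : ℝ)) :
    ‖g‖ₑ = (∫⁻ ξ, ‖ξ‖ₑ * ‖((toLp (1 / 2 : ℝ) g : Lp F 2
        (FunctionSpaces.homSobolevMeasure (EuclideanSpace ℝ (Fin 3)) (1 / 2 : ℝ))) :
          EuclideanSpace ℝ (Fin 3) → F) ξ‖ₑ ^ 2) ^ (1 / 2 : ℝ) := by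
  have hwd : ∀ h : EuclideanSpace ℝ (Fin 3) → ℝ≥0∞,
      ∫⁻ ξ, h ξ ∂(FunctionSpaces.homSobolevMeasure (EuclideanSpace ℝ (Fin 3)) (1 / 2 : ℝ)) =
        ∫⁻ ξ, ‖ξ‖ₑ * h ξ := fun h => by
    rw [HomSobolevSymmetry.homSobolevMeasure_half_eq,
      lintegral_withDensity_eq_lintegral_mul_non_measurable₀ _ (by fun_prop)
      (Eventually.of_forall fun ξ => enorm_lt_top)]
    rfl
  have h1 : ‖g‖ₑ = ‖(toLp (1 / 2 : ℝ) g : Lp F 2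
      (FunctionSpaces.homSobolevMeasure (EuclideanSpace ℝ (Fin 3)) (1 / 2 : ℝ)))‖ₑ := rfl
  rw [h1, Lp.enorm_def, eLpNorm_eq_lintegral_rpow_enorm_toReal two_ne_zero ENNReal.ofNat_ne_top,
    ENNReal.toReal_ofNat, ← hwd]
  simp only [ENNReal.rpow_ofNat, one_div]

omit [CompleteSpace F] in
/-- **The low-frequency symbol is integrable**: for `g ∈ Ḣ^{1/2}(ℝ³)` and `Λ > 0`,
`1_{B(0,Λ)} ĝ ∈ L¹(dξ)` with `∫ ‖1_{B(0,Λ)} ĝ‖ ≤ Λ J₁^{1/2} ‖g‖`, `J₁ = ∫_{B(0,1)} ‖ξ‖⁻¹ dξ < ∞`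
(Cauchy–Schwarz against `‖ξ‖^{-1/2}` on the ball; Chemin–Xu 1997, (9); the tree's
`SobolevEmbeddingHalf.lintegral_ball_enorm_le_mul`). [cite: CheminXu1997, Introduction (9), p. 723] -/
theorem _root_.Literature.Analysis.FunctionSpaces.HomSobolev.integrable_indicator_ball_toLp
    (g : HomSobolev (EuclideanSpace ℝ (Fin 3)) F (1 / 2 : ℝ)) {Λ : ℝ} (hΛ : 0 < Λ) :
    Integrable ((Metric.ball (0 : EuclideanSpace ℝ (Fin 3)) Λ).indicator
      ((toLp (1 / 2 : ℝ) g : Lp F 2 (FunctionSpaces.homSobolevMeasure (EuclideanSpace ℝ (Fin 3)) (1 / 2 : ℝ))) :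
        EuclideanSpace ℝ (Fin 3) → F)) volume ∧
    ∫⁻ ξ, ‖(Metric.ball (0 : EuclideanSpace ℝ (Fin 3)) Λ).indicator
      ((toLp (1 / 2 : ℝ) g : Lp F 2 (FunctionSpaces.homSobolevMeasure (EuclideanSpace ℝ (Fin 3)) (1 / 2 : ℝ))) :
        EuclideanSpace ℝ (Fin 3) → F) ξ‖ₑ ≤
      ENNReal.ofReal Λ * (∫⁻ ξ in Metric.ball (0 : EuclideanSpace ℝ (Fin 3)) 1, ‖ξ‖ₑ⁻¹) ^ (1 / 2 : ℝ) * ‖g‖ₑ := by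
  set μ := FunctionSpaces.homSobolevMeasure (EuclideanSpace ℝ (Fin 3)) (1 / 2 : ℝ) with hμ
  have hac : (volume : Measure (EuclideanSpace ℝ (Fin 3))) ≪ μ :=
    HomSobolevSymmetry.volume_absolutelyContinuous_homSobolevMeasure_half
  set G : EuclideanSpace ℝ (Fin 3) → F := ((toLp (1 / 2 : ℝ) g : Lp F 2 μ) : EuclideanSpace ℝ (Fin 3) → F)
    with hG_def
  have hG : MemLp G 2 μ := Lp.memLp _
  have hGm : AEStronglyMeasurable G volume := hG.1.mono_ac hac
  set B : Set (EuclideanSpace ℝ (Fin 3)) := Metric.ball 0 Λ with hB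
  have hBm : MeasurableSet B := measurableSet_ball
  have hbound : ∫⁻ ξ, ‖B.indicator G ξ‖ₑ ≤
      ENNReal.ofReal Λ * (∫⁻ ξ in Metric.ball (0 : EuclideanSpace ℝ (Fin 3)) 1, ‖ξ‖ₑ⁻¹) ^ (1 / 2 : ℝ) * ‖g‖ₑ := by
    have h1 : ∫⁻ ξ, ‖B.indicator G ξ‖ₑ = ∫⁻ ξ in B, ‖G ξ‖ₑ := by
      rw [← lintegral_indicator hBm]
      refine lintegral_congr fun ξ => ?_
      rw [enorm_indicator_eq_indicator_enorm]
    rw [h1, enorm_eq_lintegral_weight g]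
    exact FunctionSpaces.SobolevEmbeddingHalf.lintegral_ball_enorm_le_mul hGm hΛ
  have htop : ∫⁻ ξ, ‖B.indicator G ξ‖ₑ < ∞ := by
    refine lt_of_le_of_lt hbound (ENNReal.mul_lt_top (ENNReal.mul_lt_top ENNReal.ofReal_lt_top ?_)
      enorm_lt_top)
    exact ENNReal.rpow_lt_top_of_nonneg (by norm_num)
      FunctionSpaces.SobolevEmbeddingHalf.lintegral_unitBall_inv_enorm_ne_top
  exact ⟨⟨hGm.indicator hBm, htop⟩, hbound⟩

omit [CompleteSpace F] in
/-- **The high-frequency symbol is square integrable**: for `g ∈ Ḣ^{1/2}(ℝ³)` and `Λ > 0`,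
`1_{B(0,Λ)ᶜ} ĝ ∈ L²(dξ)` with `‖1_{B(0,Λ)ᶜ} ĝ‖_{L²(dξ)} ≤ Λ^{-1/2} ‖g‖`, since `1 ≤ Λ⁻¹‖ξ‖` off
the ball (Rusin–Šverák 2011, §4 p. 6: "`v₀` in `L²`"; Chemin–Xu 1997, (10)).
[cite: RusinSverak2011, §4 p. 6 (arXiv:0911.0500: v₀ ∈ L²)] -/
theorem _root_.Literature.Analysis.FunctionSpaces.HomSobolev.memLp_indicator_compl_ball_toLp
    (g : HomSobolev (EuclideanSpace ℝ (Fin 3)) F (1 / 2 : ℝ)) {Λ : ℝ} (hΛ : 0 < Λ) :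
    MemLp ((Metric.ball (0 : EuclideanSpace ℝ (Fin 3)) Λ)ᶜ.indicator
      ((toLp (1 / 2 : ℝ) g : Lp F 2 (FunctionSpaces.homSobolevMeasure (EuclideanSpace ℝ (Fin 3)) (1 / 2 : ℝ))) :
        EuclideanSpace ℝ (Fin 3) → F)) 2 volume ∧
    eLpNorm ((Metric.ball (0 : EuclideanSpace ℝ (Fin 3)) Λ)ᶜ.indicator
      ((toLp (1 / 2 : ℝ) g : Lp F 2 (FunctionSpaces.homSobolevMeasure (EuclideanSpace ℝ (Fin 3)) (1 / 2 : ℝ))) :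
        EuclideanSpace ℝ (Fin 3) → F)) 2 volume ≤ ENNReal.ofReal Λ⁻¹ ^ (1 / 2 : ℝ) * ‖g‖ₑ := by
  set μ := FunctionSpaces.homSobolevMeasure (EuclideanSpace ℝ (Fin 3)) (1 / 2 : ℝ) with hμ
  have hac : (volume : Measure (EuclideanSpace ℝ (Fin 3))) ≪ μ :=
    HomSobolevSymmetry.volume_absolutelyContinuous_homSobolevMeasure_half
  have hwd : ∀ h : EuclideanSpace ℝ (Fin 3) → ℝ≥0∞, ∫⁻ ξ, h ξ ∂μ = ∫⁻ ξ, ‖ξ‖ₑ * h ξ := fun h => by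
    rw [hμ, HomSobolevSymmetry.homSobolevMeasure_half_eq,
      lintegral_withDensity_eq_lintegral_mul_non_measurable₀ _ (by fun_prop)
      (Eventually.of_forall fun ξ => enorm_lt_top)]
    rfl
  set G : EuclideanSpace ℝ (Fin 3) → F := ((toLp (1 / 2 : ℝ) g : Lp F 2 μ) : EuclideanSpace ℝ (Fin 3) → F)
    with hG_def
  have hG : MemLp G 2 μ := Lp.memLp _
  have hGm : AEStronglyMeasurable G volume := hG.1.mono_ac hac
  set A : Set (EuclideanSpace ℝ (Fin 3)) := (Metric.ball 0 Λ)ᶜ with hA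
  have hAm : MeasurableSet A := measurableSet_ball.compl
  have ha : MemLp (A.indicator G) 2 μ := hG.indicator hAm
  -- pointwise: off the ball, `1 ≤ Λ⁻¹ ‖ξ‖`
  have hle : ∀ ξ, ‖A.indicator G ξ‖ₑ ^ 2 ≤ ENNReal.ofReal Λ⁻¹ * (‖ξ‖ₑ * ‖A.indicator G ξ‖ₑ ^ 2) :=
    fun ξ => by
    by_cases hξ : ξ ∈ A
    · have h1 : (1 : ℝ≥0∞) ≤ ENNReal.ofReal Λ⁻¹ * ‖ξ‖ₑ := by
        rw [← ofReal_norm, ← ENNReal.ofReal_mul (by positivity), ← ENNReal.ofReal_one]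
        refine ENNReal.ofReal_le_ofReal ?_
        have hξ' : Λ ≤ ‖ξ‖ := by simpa [hA] using hξ
        calc (1 : ℝ) = Λ⁻¹ * Λ := by field_simp
          _ ≤ Λ⁻¹ * ‖ξ‖ := by gcongr
      calc ‖A.indicator G ξ‖ₑ ^ 2 = 1 * ‖A.indicator G ξ‖ₑ ^ 2 := (one_mul _).symm
        _ ≤ (ENNReal.ofReal Λ⁻¹ * ‖ξ‖ₑ) * ‖A.indicator G ξ‖ₑ ^ 2 := by gcongr
        _ = _ := by ring
    · simp [Set.indicator_of_notMem hξ]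
  have hsq : ∫⁻ ξ, ‖A.indicator G ξ‖ₑ ^ 2 ≤ ENNReal.ofReal Λ⁻¹ * ∫⁻ ξ, ‖A.indicator G ξ‖ₑ ^ 2 ∂μ :=
    calc ∫⁻ ξ, ‖A.indicator G ξ‖ₑ ^ 2 ≤ ∫⁻ ξ, ENNReal.ofReal Λ⁻¹ * (‖ξ‖ₑ * ‖A.indicator G ξ‖ₑ ^ 2) :=
          lintegral_mono hle
      _ = ENNReal.ofReal Λ⁻¹ * ∫⁻ ξ, ‖A.indicator G ξ‖ₑ ^ 2 ∂μ := by
          rw [lintegral_const_mul' _ _ ENNReal.ofReal_ne_top, hwd]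
  have hfinμ : ∫⁻ ξ, ‖A.indicator G ξ‖ₑ ^ 2 ∂μ < ∞ := by
    have := lintegral_rpow_enorm_lt_top_of_eLpNorm_lt_top two_ne_zero ENNReal.ofNat_ne_top
      ha.eLpNorm_lt_top
    simpa only [ENNReal.toReal_ofNat, ENNReal.rpow_ofNat] using this
  have hb : MemLp (A.indicator G) 2 (volume : Measure (EuclideanSpace ℝ (Fin 3))) := by
    refine ⟨hGm.indicator hAm, ?_⟩
    rw [eLpNorm_lt_top_iff_lintegral_rpow_enorm_lt_top two_ne_zero ENNReal.ofNat_ne_top]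
    simp only [ENNReal.toReal_ofNat, ENNReal.rpow_ofNat]
    exact lt_of_le_of_lt hsq (ENNReal.mul_lt_top ENNReal.ofReal_lt_top hfinμ)
  refine ⟨hb, ?_⟩
  -- take square roots
  have e1 : eLpNorm (A.indicator G) 2 volume = (∫⁻ ξ, ‖A.indicator G ξ‖ₑ ^ 2) ^ (1 / 2 : ℝ) := by
    rw [eLpNorm_eq_lintegral_rpow_enorm_toReal two_ne_zero ENNReal.ofNat_ne_top]
    simp [ENNReal.rpow_ofNat]
  have e2 : eLpNorm (A.indicator G) 2 μ = (∫⁻ ξ, ‖A.indicator G ξ‖ₑ ^ 2 ∂μ) ^ (1 / 2 : ℝ) := by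
    rw [eLpNorm_eq_lintegral_rpow_enorm_toReal two_ne_zero ENNReal.ofNat_ne_top]
    simp [ENNReal.rpow_ofNat]
  have e3 : eLpNorm (A.indicator G) 2 μ ≤ ‖g‖ₑ := by
    have h1 : ‖g‖ₑ = ‖(toLp (1 / 2 : ℝ) g : Lp F 2 μ)‖ₑ := rfl
    rw [h1, Lp.enorm_def]
    exact eLpNorm_indicator_le _
  calc eLpNorm (A.indicator G) 2 volume = (∫⁻ ξ, ‖A.indicator G ξ‖ₑ ^ 2) ^ (1 / 2 : ℝ) := e1
    _ ≤ (ENNReal.ofReal Λ⁻¹ * ∫⁻ ξ, ‖A.indicator G ξ‖ₑ ^ 2 ∂μ) ^ (1 / 2 : ℝ) := by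
        gcongr
    _ = ENNReal.ofReal Λ⁻¹ ^ (1 / 2 : ℝ) * eLpNorm (A.indicator G) 2 μ := by
        rw [ENNReal.mul_rpow_of_nonneg _ _ (by norm_num : (0 : ℝ) ≤ 1 / 2), e2]
    _ ≤ ENNReal.ofReal Λ⁻¹ ^ (1 / 2 : ℝ) * ‖g‖ₑ := by gcongr

/-- **The low-frequency part is a smooth bounded function.** Let `g ∈ Ḣ^{1/2}(ℝ³; F)`, `Λ > 0`,
and let `g₁` be the class whose stored representative is `1_{B(0,Λ)} ĝ` a.e. Then `g₁`
represents the inverse Fourier integral `a₀ = 𝓕⁻¹(1_{B(0,Λ)} ĝ)` (`HomSobolev.Represents`; the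
pairing identity is `∫ 𝓕φ • 𝓕⁻¹G = ∫ 𝓕⁻¹𝓕φ • G = ∫ φ • G`,
`SobolevEmbeddingHalf.integral_fourierInv_schwartz_smul_eq`), and `a₀` is continuous, `C^∞`
(all moments of the compactly supported `L¹` symbol are finite, Mathlib `Real.contDiff_fourier`),
and bounded: `‖a₀(x)‖ ≤ ‖1_{B(0,Λ)} ĝ‖_{L¹} ≤ Λ J₁^{1/2} ‖g‖` (Rusin–Šverák 2011, §4 p. 6: "`a₀`
smooth"; Chemin–Xu 1997, (9)). [cite: RusinSverak2011, §4 p. 6 (arXiv:0911.0500: a₀ smooth, â₀ = û₀ φ)] -/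
theorem _root_.Literature.Analysis.FunctionSpaces.HomSobolev.fourierInv_indicator_ball_toLp
    (g : HomSobolev (EuclideanSpace ℝ (Fin 3)) F (1 / 2 : ℝ)) {Λ : ℝ} (hΛ : 0 < Λ)
    {g₁ : HomSobolev (EuclideanSpace ℝ (Fin 3)) F (1 / 2 : ℝ)}
    (hg₁ : ((toLp (1 / 2 : ℝ) g₁ : Lp F 2 (FunctionSpaces.homSobolevMeasure (EuclideanSpace ℝ (Fin 3)) (1 / 2 : ℝ))) :
          EuclideanSpace ℝ (Fin 3) → F) =ᵐ[volume]
        (Metric.ball (0 : EuclideanSpace ℝ (Fin 3)) Λ).indicator ((toLp (1 / 2 : ℝ) g : Lp F 2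
          (FunctionSpaces.homSobolevMeasure (EuclideanSpace ℝ (Fin 3)) (1 / 2 : ℝ))) : EuclideanSpace ℝ (Fin 3) → F)) :
    g₁.Represents (𝓕⁻ ((Metric.ball (0 : EuclideanSpace ℝ (Fin 3)) Λ).indicator
        ((toLp (1 / 2 : ℝ) g : Lp F 2 (FunctionSpaces.homSobolevMeasure (EuclideanSpace ℝ (Fin 3)) (1 / 2 : ℝ))) :
          EuclideanSpace ℝ (Fin 3) → F))) ∧
    Continuous (𝓕⁻ ((Metric.ball (0 : EuclideanSpace ℝ (Fin 3)) Λ).indicator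
        ((toLp (1 / 2 : ℝ) g : Lp F 2 (FunctionSpaces.homSobolevMeasure (EuclideanSpace ℝ (Fin 3)) (1 / 2 : ℝ))) :
          EuclideanSpace ℝ (Fin 3) → F))) ∧
    ContDiff ℝ ((⊤ : ℕ∞) : WithTop ℕ∞) (𝓕⁻ ((Metric.ball (0 : EuclideanSpace ℝ (Fin 3)) Λ).indicator
        ((toLp (1 / 2 : ℝ) g : Lp F 2 (FunctionSpaces.homSobolevMeasure (EuclideanSpace ℝ (Fin 3)) (1 / 2 : ℝ))) :
          EuclideanSpace ℝ (Fin 3) → F))) ∧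
    ∀ x, ‖𝓕⁻ ((Metric.ball (0 : EuclideanSpace ℝ (Fin 3)) Λ).indicator
        ((toLp (1 / 2 : ℝ) g : Lp F 2 (FunctionSpaces.homSobolevMeasure (EuclideanSpace ℝ (Fin 3)) (1 / 2 : ℝ))) :
          EuclideanSpace ℝ (Fin 3) → F)) x‖ₑ ≤
      ENNReal.ofReal Λ * (∫⁻ ξ in Metric.ball (0 : EuclideanSpace ℝ (Fin 3)) 1, ‖ξ‖ₑ⁻¹) ^ (1 / 2 : ℝ) * ‖g‖ₑ := by
  set μ := FunctionSpaces.homSobolevMeasure (EuclideanSpace ℝ (Fin 3)) (1 / 2 : ℝ) with hμ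
  set G : EuclideanSpace ℝ (Fin 3) → F := ((toLp (1 / 2 : ℝ) g : Lp F 2 μ) : EuclideanSpace ℝ (Fin 3) → F)
    with hG_def
  have hG : MemLp G 2 μ := Lp.memLp _
  set B : Set (EuclideanSpace ℝ (Fin 3)) := Metric.ball 0 Λ with hB
  have hBm : MeasurableSet B := measurableSet_ball
  set K : EuclideanSpace ℝ (Fin 3) → F := B.indicator G with hK
  obtain ⟨hint, hbound⟩ := integrable_indicator_ball_toLp g hΛ
  have hcont : Continuous (𝓕⁻ K) := FunctionSpaces.SobolevEmbeddingHalf.continuous_fourierIntegralInv hint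
  have hnorm : ∀ x, ‖𝓕⁻ K x‖ ≤ ∫ ξ, ‖K ξ‖ := fun x =>
    FunctionSpaces.SobolevEmbeddingHalf.norm_fourierIntegralInv_le_integral_norm K x
  have henorm : ∀ x, ‖𝓕⁻ K x‖ₑ ≤
      ENNReal.ofReal Λ * (∫⁻ ξ in Metric.ball (0 : EuclideanSpace ℝ (Fin 3)) 1, ‖ξ‖ₑ⁻¹) ^ (1 / 2 : ℝ) * ‖g‖ₑ :=
    fun x => by
    refine le_trans ?_ hbound
    rw [← ofReal_norm, ← ofReal_integral_norm_eq_lintegral_enorm hint]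
    exact ENNReal.ofReal_le_ofReal (hnorm x)
  -- smoothness: the symbol is compactly supported in frequency
  have hsupp : ∀ v, K v ≠ 0 → ‖v‖ < Λ := fun v hv => by
    by_contra hcon
    exact hv (Set.indicator_of_notMem (by simpa [hB] using hcon) G)
  have hsmooth : ContDiff ℝ ((⊤ : ℕ∞) : WithTop ℕ∞) (𝓕⁻ K) := by
    rw [Real.fourierInv_eq_fourier_comp_neg]
    refine Real.contDiff_fourier fun n _ => ?_
    have hKn : Integrable (fun v => K (-v)) volume := hint.comp_neg
    refine ((hKn.norm.const_mul (Λ ^ n)).mono' ?_ (Eventually.of_forall fun v => ?_))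
    · exact (continuous_norm.pow n).aestronglyMeasurable.mul hKn.norm.aestronglyMeasurable
    · rw [Real.norm_of_nonneg (by positivity)]
      by_cases hv : K (-v) = 0
      · simp [hv]
      · have h1 : ‖v‖ < Λ := by simpa using hsupp (-v) hv
        have h2 : ‖v‖ ^ n ≤ Λ ^ n := pow_le_pow_left₀ (norm_nonneg _) h1.le n
        exact mul_le_mul_of_nonneg_right h2 (norm_nonneg _)
  refine ⟨⟨fun φ => ?_, fun φ => ?_, fun φ => ?_⟩, hcont, hsmooth, henorm⟩
  · -- `𝓕φ • 𝓕⁻¹K` is integrable: `𝓕φ ∈ L¹`, `𝓕⁻¹K` bounded continuous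
    refine (((𝓕 φ).integrable.norm.mul_const (∫ ξ, ‖K ξ‖)).mono'
      ((𝓕 φ).continuous.aestronglyMeasurable.smul hcont.aestronglyMeasurable)
      (Eventually.of_forall fun x => ?_))
    rw [norm_smul]
    gcongr
    exact hnorm x
  · exact integrable_smul_of_memLp_half φ (Lp.memLp _)
  · have key := FunctionSpaces.SobolevEmbeddingHalf.integral_fourierInv_schwartz_smul_eq (𝓕 φ) hint
    have hFF : 𝓕⁻ ((𝓕 φ : 𝓢(EuclideanSpace ℝ (Fin 3), ℂ)) : EuclideanSpace ℝ (Fin 3) → ℂ) =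
        (φ : EuclideanSpace ℝ (Fin 3) → ℂ) := by
      rw [← SchwartzMap.fourierInv_coe, fourierInv_fourier_eq]
    rw [hFF] at key
    rw [← key]
    refine integral_congr_ae ?_
    filter_upwards [hg₁] with ξ hξ
    rw [hξ]

/-- **The high-frequency part is an `L²` function.** Let `g ∈ Ḣ^{1/2}(ℝ³; F)`, `Λ > 0`, and
let `g₂` be the class whose stored representative is `1_{B(0,Λ)ᶜ} ĝ` a.e. Then `g₂` represents
an `L²` function `v₀` (the `L²` inverse Fourier transform of `1_{B(0,Λ)ᶜ} ĝ ∈ L²(dξ)`; pairing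
identity by Parseval, `HomSobolev.integral_fourier_smul_eq_integral_smul_fourier_Lp`) with
`‖v₀‖_{L²} = ‖1_{B(0,Λ)ᶜ} ĝ‖_{L²(dξ)} ≤ Λ^{-1/2} ‖g‖` (Plancherel; Rusin–Šverák 2011, §4 p. 6:
"`v₀` in `L²`"). [cite: RusinSverak2011, §4 p. 6 (arXiv:0911.0500: v₀ ∈ L²)] -/
theorem _root_.Literature.Analysis.FunctionSpaces.HomSobolev.exists_represents_indicator_compl_ball_toLp
    (g : HomSobolev (EuclideanSpace ℝ (Fin 3)) F (1 / 2 : ℝ)) {Λ : ℝ} (hΛ : 0 < Λ)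
    {g₂ : HomSobolev (EuclideanSpace ℝ (Fin 3)) F (1 / 2 : ℝ)}
    (hg₂ : ((toLp (1 / 2 : ℝ) g₂ : Lp F 2 (FunctionSpaces.homSobolevMeasure (EuclideanSpace ℝ (Fin 3)) (1 / 2 : ℝ))) :
          EuclideanSpace ℝ (Fin 3) → F) =ᵐ[volume]
        (Metric.ball (0 : EuclideanSpace ℝ (Fin 3)) Λ)ᶜ.indicator ((toLp (1 / 2 : ℝ) g : Lp F 2
          (FunctionSpaces.homSobolevMeasure (EuclideanSpace ℝ (Fin 3)) (1 / 2 : ℝ))) : EuclideanSpace ℝ (Fin 3) → F)) :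
    ∃ f₂ : EuclideanSpace ℝ (Fin 3) → F, g₂.Represents f₂ ∧ MemLp f₂ 2 volume ∧
      eLpNorm f₂ 2 volume ≤ ENNReal.ofReal Λ⁻¹ ^ (1 / 2 : ℝ) * ‖g‖ₑ := by
  set μ := FunctionSpaces.homSobolevMeasure (EuclideanSpace ℝ (Fin 3)) (1 / 2 : ℝ) with hμ
  set G : EuclideanSpace ℝ (Fin 3) → F := ((toLp (1 / 2 : ℝ) g : Lp F 2 μ) : EuclideanSpace ℝ (Fin 3) → F)
    with hG_def
  have hG : MemLp G 2 μ := Lp.memLp _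
  set A : Set (EuclideanSpace ℝ (Fin 3)) := (Metric.ball 0 Λ)ᶜ with hA
  have hAm : MeasurableSet A := measurableSet_ball.compl
  have ha : MemLp (A.indicator G) 2 μ := hG.indicator hAm
  obtain ⟨hb, hbd⟩ := memLp_indicator_compl_ball_toLp g hΛ
  set H : Lp F 2 (volume : Measure (EuclideanSpace ℝ (Fin 3))) := hb.toLp (A.indicator G) with hH_def
  have hHae : (H : EuclideanSpace ℝ (Fin 3) → F) =ᵐ[volume] A.indicator G := hb.coeFn_toLp
  set Φ : Lp F 2 (volume : Measure (EuclideanSpace ℝ (Fin 3))) := 𝓕⁻ H with hΦ_def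
  have hΦ : (𝓕 Φ : Lp F 2 (volume : Measure (EuclideanSpace ℝ (Fin 3)))) = H := fourier_fourierInv_eq H
  refine ⟨(Φ : EuclideanSpace ℝ (Fin 3) → F), ⟨fun φ => ?_, fun φ => ?_, fun φ => ?_⟩, Lp.memLp Φ, ?_⟩
  · exact integrable_schwartz_smul (𝓕 φ) (Lp.memLp Φ)
  · exact integrable_smul_of_memLp_half φ (Lp.memLp _)
  · rw [integral_fourier_smul_eq_integral_smul_fourier_Lp φ Φ, hΦ]
    refine integral_congr_ae ?_
    filter_upwards [hHae, hg₂] with ξ h1 h2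
    rw [h1, h2]
  · have h1 : eLpNorm (Φ : EuclideanSpace ℝ (Fin 3) → F) 2 volume = ‖Φ‖ₑ := (Lp.enorm_def Φ).symm
    have h2 : ‖Φ‖ₑ = ‖(𝓕 Φ : Lp F 2 (volume : Measure (EuclideanSpace ℝ (Fin 3))))‖ₑ := by
      rw [← ofReal_norm, ← ofReal_norm, Lp.norm_fourier_eq]
    rw [h1, h2, hΦ, Lp.enorm_def, eLpNorm_congr_ae hHae]
    exact hbd

/-- **Frequency splitting of a represented field** (Calderón's trick on the Fourier side,
Rusin–Šverák 2011, §4 p. 6, for a general represented field and the sharp cutoff at frequency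
`Λ > 0`). If `g ∈ Ḣ^{1/2}(ℝ³; F)` represents `f`, then `g = g₁ + g₂` and `f = a₀ + v₀` a.e.,
where `ĝ₁ = 1_{B(0,Λ)} ĝ`, `ĝ₂ = 1_{B(0,Λ)ᶜ} ĝ` (a.e.), `‖g₁‖ = ‖1_{B(0,Λ)} ĝ‖_{L²(‖ξ‖dξ)}`,
`‖gᵢ‖ ≤ ‖g‖`; `g₁` represents the continuous, `C^∞`, bounded function
`a₀ = 𝓕⁻¹(1_{B(0,Λ)} ĝ)` with `‖a₀‖_∞ ≤ Λ J₁^{1/2} ‖g‖`; `g₂` represents `v₀ ∈ L²` with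
`‖v₀‖_{L²} ≤ Λ^{-1/2} ‖g‖`. The a.e. identity `f = a₀ + v₀` is `Represents.add` with the
uniqueness of the represented field (`Represents.ae_eq`).
[cite: RusinSverak2011, §4 p. 6 (arXiv:0911.0500: u₀ = a₀ + v₀, â₀ = û₀ φ, v₀ ∈ L²)] -/
theorem _root_.Literature.Analysis.FunctionSpaces.HomSobolev.Represents.exists_frequency_split
    {g : HomSobolev (EuclideanSpace ℝ (Fin 3)) F (1 / 2 : ℝ)} {f : EuclideanSpace ℝ (Fin 3) → F}
    (h : g.Represents f) {Λ : ℝ} (hΛ : 0 < Λ) :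
    ∃ (g₁ g₂ : HomSobolev (EuclideanSpace ℝ (Fin 3)) F (1 / 2 : ℝ)) (f₂ : EuclideanSpace ℝ (Fin 3) → F),
      g = g₁ + g₂ ∧
      ((toLp (1 / 2 : ℝ) g₁ : Lp F 2 (FunctionSpaces.homSobolevMeasure (EuclideanSpace ℝ (Fin 3)) (1 / 2 : ℝ))) :
          EuclideanSpace ℝ (Fin 3) → F) =ᵐ[volume]
        (Metric.ball (0 : EuclideanSpace ℝ (Fin 3)) Λ).indicator ((toLp (1 / 2 : ℝ) g : Lp F 2
          (FunctionSpaces.homSobolevMeasure (EuclideanSpace ℝ (Fin 3)) (1 / 2 : ℝ))) : EuclideanSpace ℝ (Fin 3) → F) ∧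
      ((toLp (1 / 2 : ℝ) g₂ : Lp F 2 (FunctionSpaces.homSobolevMeasure (EuclideanSpace ℝ (Fin 3)) (1 / 2 : ℝ))) :
          EuclideanSpace ℝ (Fin 3) → F) =ᵐ[volume]
        (Metric.ball (0 : EuclideanSpace ℝ (Fin 3)) Λ)ᶜ.indicator ((toLp (1 / 2 : ℝ) g : Lp F 2
          (FunctionSpaces.homSobolevMeasure (EuclideanSpace ℝ (Fin 3)) (1 / 2 : ℝ))) : EuclideanSpace ℝ (Fin 3) → F) ∧
      ‖g₁‖ = (eLpNorm ((Metric.ball (0 : EuclideanSpace ℝ (Fin 3)) Λ).indicator ((toLp (1 / 2 : ℝ) g : Lp F 2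
          (FunctionSpaces.homSobolevMeasure (EuclideanSpace ℝ (Fin 3)) (1 / 2 : ℝ))) : EuclideanSpace ℝ (Fin 3) → F))
          2 (FunctionSpaces.homSobolevMeasure (EuclideanSpace ℝ (Fin 3)) (1 / 2 : ℝ))).toReal ∧
      ‖g₁‖ ≤ ‖g‖ ∧ ‖g₂‖ ≤ ‖g‖ ∧
      g₁.Represents (𝓕⁻ ((Metric.ball (0 : EuclideanSpace ℝ (Fin 3)) Λ).indicator
        ((toLp (1 / 2 : ℝ) g : Lp F 2 (FunctionSpaces.homSobolevMeasure (EuclideanSpace ℝ (Fin 3)) (1 / 2 : ℝ))) :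
          EuclideanSpace ℝ (Fin 3) → F))) ∧
      g₂.Represents f₂ ∧
      f =ᵐ[volume] 𝓕⁻ ((Metric.ball (0 : EuclideanSpace ℝ (Fin 3)) Λ).indicator
        ((toLp (1 / 2 : ℝ) g : Lp F 2 (FunctionSpaces.homSobolevMeasure (EuclideanSpace ℝ (Fin 3)) (1 / 2 : ℝ))) :
          EuclideanSpace ℝ (Fin 3) → F)) + f₂ ∧
      Continuous (𝓕⁻ ((Metric.ball (0 : EuclideanSpace ℝ (Fin 3)) Λ).indicator
        ((toLp (1 / 2 : ℝ) g : Lp F 2 (FunctionSpaces.homSobolevMeasure (EuclideanSpace ℝ (Fin 3)) (1 / 2 : ℝ))) :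
          EuclideanSpace ℝ (Fin 3) → F))) ∧
      ContDiff ℝ ((⊤ : ℕ∞) : WithTop ℕ∞) (𝓕⁻ ((Metric.ball (0 : EuclideanSpace ℝ (Fin 3)) Λ).indicator
        ((toLp (1 / 2 : ℝ) g : Lp F 2 (FunctionSpaces.homSobolevMeasure (EuclideanSpace ℝ (Fin 3)) (1 / 2 : ℝ))) :
          EuclideanSpace ℝ (Fin 3) → F))) ∧
      (∀ x, ‖𝓕⁻ ((Metric.ball (0 : EuclideanSpace ℝ (Fin 3)) Λ).indicator
        ((toLp (1 / 2 : ℝ) g : Lp F 2 (FunctionSpaces.homSobolevMeasure (EuclideanSpace ℝ (Fin 3)) (1 / 2 : ℝ))) :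
          EuclideanSpace ℝ (Fin 3) → F)) x‖ₑ ≤
        ENNReal.ofReal Λ * (∫⁻ ξ in Metric.ball (0 : EuclideanSpace ℝ (Fin 3)) 1, ‖ξ‖ₑ⁻¹) ^ (1 / 2 : ℝ) * ‖g‖ₑ) ∧
      MemLp f₂ 2 volume ∧ eLpNorm f₂ 2 volume ≤ ENNReal.ofReal Λ⁻¹ ^ (1 / 2 : ℝ) * ‖g‖ₑ := by
  obtain ⟨g₁, g₂, hsum, hc₁, hc₂, hn₁, -, hle₁, hle₂⟩ :=
    exists_indicator_pair g (measurableSet_ball : MeasurableSet (Metric.ball (0 : EuclideanSpace ℝ (Fin 3)) Λ))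
  obtain ⟨hrep₁, hcont, hsmooth, hbound⟩ := fourierInv_indicator_ball_toLp g hΛ hc₁
  obtain ⟨f₂, hrep₂, hf₂, hf₂n⟩ := exists_represents_indicator_compl_ball_toLp g hΛ hc₂
  refine ⟨g₁, g₂, f₂, hsum, hc₁, hc₂, hn₁, hle₁, hle₂, hrep₁, hrep₂, ?_, hcont, hsmooth, hbound, hf₂, hf₂n⟩
  have hrep := hrep₁.add hrep₂
  rw [← hsum] at hrep
  exact h.ae_eq hrep

omit [CompleteSpace F] in
/-- **The low-frequency part is small in `Ḣ^{1/2}`**: `‖1_{B(0,1/(n+1))} ĝ‖_{L²(‖ξ‖dξ)} → 0`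
(dominated convergence: the balls shrink to the Lebesgue- and `‖ξ‖dξ`-null set `{0}`). This is
"`a₀` [...] small in `Ḣ^{1/2}` [...] `φ` equal to `1` in a small neighborhood of `0`" of
Rusin–Šverák 2011, §4 p. 6. [cite: RusinSverak2011, §4 p. 6 (arXiv:0911.0500: a₀ small in Ḣ^{1/2})] -/
theorem _root_.Literature.Analysis.FunctionSpaces.HomSobolev.tendsto_eLpNorm_indicator_ball_toLp
    (g : HomSobolev (EuclideanSpace ℝ (Fin 3)) F (1 / 2 : ℝ)) :
    Tendsto (fun n : ℕ => eLpNorm ((Metric.ball (0 : EuclideanSpace ℝ (Fin 3)) ((n : ℝ) + 1)⁻¹).indicator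
      ((toLp (1 / 2 : ℝ) g : Lp F 2 (FunctionSpaces.homSobolevMeasure (EuclideanSpace ℝ (Fin 3)) (1 / 2 : ℝ))) :
        EuclideanSpace ℝ (Fin 3) → F)) 2
      (FunctionSpaces.homSobolevMeasure (EuclideanSpace ℝ (Fin 3)) (1 / 2 : ℝ))) atTop (𝓝 0) := by
  set μ := FunctionSpaces.homSobolevMeasure (EuclideanSpace ℝ (Fin 3)) (1 / 2 : ℝ) with hμ
  have hac' : μ ≪ (volume : Measure (EuclideanSpace ℝ (Fin 3))) :=
    HomSobolevSymmetry.homSobolevMeasure_half_absolutelyContinuous_volume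
  set G : EuclideanSpace ℝ (Fin 3) → F := ((toLp (1 / 2 : ℝ) g : Lp F 2 μ) : EuclideanSpace ℝ (Fin 3) → F)
    with hG_def
  have hG : MemLp G 2 μ := Lp.memLp _
  set B : ℕ → Set (EuclideanSpace ℝ (Fin 3)) :=
    fun n => Metric.ball (0 : EuclideanSpace ℝ (Fin 3)) (((n : ℝ) + 1)⁻¹) with hB_def
  have hBm : ∀ n, MeasurableSet (B n) := fun n => measurableSet_ball
  set Gn : ℕ → EuclideanSpace ℝ (Fin 3) → F := fun n => (B n).indicator G with hGn_def
  have ha : ∀ n, MemLp (Gn n) 2 μ := fun n => hG.indicator (hBm n)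
  have h0 : ∀ᵐ ξ ∂(volume : Measure (EuclideanSpace ℝ (Fin 3))), ξ ≠ 0 := by
    rw [ae_iff]; simp [measure_singleton]
  have hlin : Tendsto (fun n => ∫⁻ ξ, ‖Gn n ξ‖ₑ ^ 2 ∂μ) atTop (𝓝 (∫⁻ _ξ, (0 : ℝ≥0∞) ∂μ)) := by
    refine tendsto_lintegral_of_dominated_convergence' (fun ξ => ‖G ξ‖ₑ ^ 2)
      (fun n => ((ha n).1.enorm.pow_const _)) (fun n => Eventually.of_forall fun ξ => ?_) ?_ ?_
    · simp only [hGn_def]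
      gcongr
      exact enorm_indicator_le_enorm_self _ _
    · have := lintegral_rpow_enorm_lt_top_of_eLpNorm_lt_top two_ne_zero ENNReal.ofNat_ne_top
        hG.eLpNorm_lt_top
      simp only [ENNReal.toReal_ofNat, ENNReal.rpow_ofNat] at this
      exact this.ne
    · filter_upwards [hac'.ae_le h0] with ξ hξ
      have hξ' : (ξ : EuclideanSpace ℝ (Fin 3)) ≠ 0 := hξ
      have hev : ∀ᶠ n : ℕ in atTop, ‖Gn n ξ‖ₑ ^ 2 = 0 := by
        have hpos : 0 < ‖ξ‖ := norm_pos_iff.2 hξ'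
        obtain ⟨N, hN⟩ := exists_nat_gt ‖ξ‖⁻¹
        refine eventually_atTop.2 ⟨N, fun n hn => ?_⟩
        have hmem : ξ ∉ B n := by
          simp only [hB_def, Metric.mem_ball, dist_zero_right, not_lt]
          rw [inv_le_comm₀ (by positivity) hpos]
          have : (N : ℝ) ≤ n := by exact_mod_cast hn
          linarith
        simp [hGn_def, Set.indicator_of_notMem hmem]
      exact tendsto_const_nhds.congr' (hev.mono fun n hn => hn.symm)
  rw [lintegral_zero] at hlin
  have h2 : ∀ n, eLpNorm (Gn n) 2 μ = (∫⁻ ξ, ‖Gn n ξ‖ₑ ^ 2 ∂μ) ^ (1 / 2 : ℝ) := fun n => by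
    rw [eLpNorm_eq_lintegral_rpow_enorm_toReal two_ne_zero ENNReal.ofNat_ne_top]
    simp [ENNReal.rpow_ofNat]
  show Tendsto (fun n => eLpNorm (Gn n) 2 μ) atTop (𝓝 0)
  simp only [h2]
  have := ((ENNReal.continuous_rpow_const (y := (1 / 2 : ℝ))).tendsto (0 : ℝ≥0∞)).comp hlin
  rw [ENNReal.zero_rpow_of_pos (show (0 : ℝ) < 1 / 2 by norm_num)] at this
  exact this

omit [CompleteSpace F] in
/-- For every `ε > 0` there is a cutoff frequency `Λ > 0` with `‖1_{B(0,Λ)} ĝ‖_{L²(‖ξ‖dξ)} < ε`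
(from `tendsto_eLpNorm_indicator_ball_toLp`); with `exists_indicator_pair` this is the `Ḣ^{1/2}`
smallness of the low-frequency class (Rusin–Šverák 2011, §4 p. 6).
[cite: RusinSverak2011, §4 p. 6 (arXiv:0911.0500: a₀ small in Ḣ^{1/2})] -/
theorem _root_.Literature.Analysis.FunctionSpaces.HomSobolev.exists_eLpNorm_indicator_ball_toLp_lt
    (g : HomSobolev (EuclideanSpace ℝ (Fin 3)) F (1 / 2 : ℝ)) {ε : ℝ} (hε : 0 < ε) :
    ∃ Λ : ℝ, 0 < Λ ∧ eLpNorm ((Metric.ball (0 : EuclideanSpace ℝ (Fin 3)) Λ).indicator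
      ((toLp (1 / 2 : ℝ) g : Lp F 2 (FunctionSpaces.homSobolevMeasure (EuclideanSpace ℝ (Fin 3)) (1 / 2 : ℝ))) :
        EuclideanSpace ℝ (Fin 3) → F)) 2
      (FunctionSpaces.homSobolevMeasure (EuclideanSpace ℝ (Fin 3)) (1 / 2 : ℝ)) < ENNReal.ofReal ε := by
  have h := tendsto_eLpNorm_indicator_ball_toLp g
  have hev := h (Iio_mem_nhds (ENNReal.ofReal_pos.2 hε))
  rw [Filter.mem_map, Filter.mem_atTop_sets] at hev
  obtain ⟨N, hN⟩ := hev
  exact ⟨((N : ℝ) + 1)⁻¹, by positivity, hN N le_rfl⟩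

end Truncation

end Literature.Analysis.FluidPDE
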